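import Literature.MathematicalPhysics.QuantumLattice.FermiRG.FKTLaddersSupportVanishing

/-!
# Feldman–Knörrer–Trubowitz, *Particle–Hole Ladders*: the Fourier-support step of Lemma II.16 for components with momentum legs

Theorem-only companion of the typer file `FKTLaddersSec1.lean` (F7a, frozen; nothing there is edited)
and sequel of `FKTLaddersSupportVanishing.lean` (F7j) for the cell `gate-hubbard-kl` (seat
hubbard-kl-t10, gen 2, 2026-08-26/27): the SUPPORT step of the proof of Lemma II.16
(`\lemLADresectornorm`; tree: the named fact `FKTLadders.ResectorizationNormBound`, licence F-075) of
J. Feldman, H. Knörrer, E. Trubowitz, *Particle–Hole Ladders*, Commun. Math. Phys. **247** (2004)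
179–194, arXiv:math-ph/0209044 [FeldmanKnorrerTrubowitz2004Ladders], for every leg-kind component
`i ∈ {0,1}⁴` with AT LEAST TWO position legs all of which change scale (F7j treated the all-position
component `i = (1,1,1,1)`).  Locators `p.N Ln` = chunk `pNNNN.txt` line `n` of the materialised arXiv
TeX, as in F7a.

THE PRINTED STEP (p.13 L48–53): "for any fixed `s₁,…,s₄`, there are at most `3⁴` choices of
`(s'₁,…,s'₄)` for which the integral `∫ ∏_ν (dx'_ν χ̂_{s_ν}((-1)^{b_ν}(x_ν-x'_ν))) f((x'₁,s'₁),…)`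
fails to vanish identically, because `f` is sectorized"; for the other components the proof says only
"the other cases are similar, but easier" (p.13 L44–45).  What changes when some legs are momentum
legs: translation invariance (Definition I.4 (ii)) now produces the phase
`∏_{μ : i_μ = 0} e^{i(-1)^{b_μ}⟨k_μ,t⟩_-}` of the frozen momenta, and the total Fourier transform
(Definition I.5 (ii)) integrates only the position legs other than the pinned one.  On the
momentum-conservation surface `k₁ - k₂ - k₃ + k₄ = 0` the product of ALL four leg phases of a common
translation is `1` (`prod_legPhase_eq_one_of_surface`), so the phase of the momentum legs cancels
against the phases of the position legs: the function `x ↦ (∏_{μ : i_μ = 1} e_μ(k_μ, x_μ)) · f|_i(x, k)`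
is invariant under common translations of the positions (`phase_mul_apply_translate`).  With this
invariant in hand the route of F7j goes through verbatim.

## Statements proved

* `pinFT_eq_pinFT_of_isTranslationInvariant` (RE-PINNING with momentum legs): for `f` translation
  invariant, `k` on the conservation surface and two position legs `π, π'` with integrable pinned
  slices, the Fourier transform of `f|_i(·, s')` pinned at `π` equals the one pinned at `π'`
  (the pinned slices are t11's `legIns i k π 0 ·` of `FKTLaddersResectorizationCore`).
* `pinFT_eq_zero_of_not_mem_extSector'`: hence `IsSectorized` (Definition I.6, rev. 3 — stated for
  the tree's `totalFT`, pinned at `Classical.choose _`) controls the transform pinned at ANY position leg.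
* `integral_resect_eq_zero_of_extSector_disjoint_gen`: for admissible ladder data, a component `i`
  with position legs `ν ≠ π`, `f` sectorized at the old scales and translation invariant with
  integrable pinned slices (momenta read from `y`), new label `s ν ∈ Σ_{new ν}`, old labels `s'`, and
  `s̃_ν(new) ∩ s̃'_ν(old) = ∅`: the resectorisation integral over ALL position legs (any decidable
  `chg` with `chg μ ↔ i μ = 1`) vanishes at every `y`.
* `resectTerm_eq_zero_of_extSector_disjoint_gen`, `…_of_two_le`: the same in the `hsupp` shape of t11's
  `resectScaledNormMax_zero_le_of_support(')` — the `s'`-summand `resectTerm` of Definition I.18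
  vanishes identically — for every component all of whose position legs change scale and which has
  at least two position legs (in the strict case `ℓ' < ℓ`, `r' < r` of the Lemma: every component
  with `≥ 2` position legs).

HYPOTHESIS beyond print, as in F7j: integrability of the pinned slices (the finiteness of the old norm,
`integrable_slice_of_scaledNormMax_ne_top`); without it the statement is false for Bochner-junk
`totalFT`s.  The components with exactly ONE position leg are NOT covered here: there the summand is
`c(k) · e^{i⟨K, y_ν⟩} · ∫ χ̂_{s_ν}(w) e^{i⟨q_ν, w⟩_-} dw` and its vanishing is the POINTWISE Fourier
inversion of `χ_{s_ν}` at the conserved momentum `q_ν` (sequel file).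

## Proof route (ours; the paper says "similar, but easier")

§0 evaluation/translation lemmas for the insertion vector `legIns`; §1 the phase bookkeeping
(`prod_legPhase_legIns`, `phase_mul_apply_translate`); §2 a measure-preserving "insert one
coordinate" equivalence indexed by an `Equiv` onto the complement of the distinguished index (F7j's
version needs a total partial inverse, which does not exist when the complement is empty — the case of
exactly two position legs); §3 re-pinning; §4 assembly (split off the position of `π`, translate it to
the origin — the momentum legs contribute a constant phase —, F7j's Fubini lemma
`integral_prod_chiHat_mul_eq_zero` on the remaining position legs, re-pinned sectorization at the
completed surface momentum).

Theorem-only: no `def`, no named fact, no `instance`, no `notation`; nothing about the Hubbard model is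
asserted.
-/

noncomputable section

open MeasureTheory Set

namespace Literature.MathematicalPhysics.QuantumLattice.FermiRG

namespace FKTLadders

/-! ### §0 The insertion vector: evaluation and translation -/

/-- The insertion vector at the pinned leg. [cite: FeldmanKnorrerTrubowitz2004Ladders, Definition I.10 (p.6 L117–128)] -/
theorem legIns_apply_self (i : LegKind) (k : Fin 4 → SpT) (π : Fin 4) (c : SpT)
    (u : {μ : Fin 4 // i μ = 1 ∧ μ ≠ π} → SpT) : legIns i k π c u π = c := by
  simp [legIns]

/-- The insertion vector on a position leg other than the pinned one. [cite: FeldmanKnorrerTrubowitz2004Ladders, Definition I.10 (p.6 L117–128)] -/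
theorem legIns_apply_of_pos (i : LegKind) (k : Fin 4 → SpT) (π : Fin 4) (c : SpT)
    (u : {μ : Fin 4 // i μ = 1 ∧ μ ≠ π} → SpT) {μ : Fin 4} (h : i μ = 1 ∧ μ ≠ π) :
    legIns i k π c u μ = u ⟨μ, h⟩ := by
  simp only [legIns, dif_pos h]

/-- The insertion vector on a momentum leg (different from the pinned leg): the frozen momentum.
[cite: FeldmanKnorrerTrubowitz2004Ladders, Definition I.10 (p.6 L117–128)] -/
theorem legIns_apply_of_mom (i : LegKind) (k : Fin 4 → SpT) (π : Fin 4) (c : SpT)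
    (u : {μ : Fin 4 // i μ = 1 ∧ μ ≠ π} → SpT) {μ : Fin 4} (h : ¬ i μ = 1) (hμ : μ ≠ π) :
    legIns i k π c u μ = k μ := by
  have h' : ¬ (i μ = 1 ∧ μ ≠ π) := fun hh => h hh.1
  simp only [legIns, dif_neg h', if_neg hμ]

/-- The insertion vector reads the momenta only on the momentum legs. [cite: FeldmanKnorrerTrubowitz2004Ladders, Definition I.10 (p.6 L117–128)] -/
theorem legIns_congr_mom (i : LegKind) {k k' : Fin 4 → SpT} (hkk' : ∀ μ, ¬ i μ = 1 → k μ = k' μ)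
    (π : Fin 4) (c : SpT) (u : {μ : Fin 4 // i μ = 1 ∧ μ ≠ π} → SpT) :
    legIns i k π c u = legIns i k' π c u := by
  funext μ
  by_cases h' : i μ = 1 ∧ μ ≠ π
  · simp only [legIns, dif_pos h']
  · simp only [legIns, dif_neg h']
    by_cases hμ : μ = π
    · rw [if_pos hμ, if_pos hμ]
    · rw [if_neg hμ, if_neg hμ]
      exact hkk' μ (fun h1 => h' ⟨h1, hμ⟩)

/-- Translating an insertion vector (Definition I.4 (i): position legs shifted, momentum legs fixed)
shifts the inserted value and the slice variables. [cite: FeldmanKnorrerTrubowitz2004Ladders, Definition I.4 (i) (p.5 L40–47)] -/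
theorem translate_legIns (i : LegKind) (k : Fin 4 → SpT) {π : Fin 4} (hπ : i π = 1) (c t : SpT)
    (u : {μ : Fin 4 // i μ = 1 ∧ μ ≠ π} → SpT) :
    translate i t (legIns i k π c u) = legIns i k π (c + t) (fun j => u j + t) := by
  funext μ
  by_cases h' : i μ = 1 ∧ μ ≠ π
  · have h0 : ¬ i μ = 0 := by have := h'.1; omega
    simp only [translate, if_neg h0, legIns, dif_pos h']
  · by_cases hμ : μ = π
    · subst hμ
      have h0 : ¬ i μ = 0 := by omega
      simp only [translate, if_neg h0, legIns, dif_neg h', if_true]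
    · have h0 : i μ = 0 := by
        have : ¬ i μ = 1 := fun h1 => h' ⟨h1, hμ⟩
        omega
      simp only [translate, if_pos h0, legIns, dif_neg h', if_neg hμ]

/-! ### §1 Phase bookkeeping: position phases, momentum phases, and the surface -/

/-- The position and the momentum phase factors of a common translation multiply to the full phase
product over the four legs. [cite: FeldmanKnorrerTrubowitz2004Ladders, Definition I.4 (ii) (p.5 L48–64)] -/
theorem prod_ite_legPhase_mul_prod_ite (i : LegKind) (k : Fin 4 → SpT) (t : SpT) :
    (∏ μ : Fin 4, if i μ = 1 then legPhase μ (k μ) t else 1) *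
        (∏ μ : Fin 4, if i μ = 0 then legPhase μ (k μ) t else 1) =
      ∏ μ : Fin 4, legPhase μ (k μ) t := by
  rw [← Finset.prod_mul_distrib]
  refine Finset.prod_congr rfl fun μ _ => ?_
  by_cases h : i μ = 1
  · have h0 : ¬ i μ = 0 := by omega
    rw [if_pos h, if_neg h0, mul_one]
  · have h0 : i μ = 0 := by omega
    rw [if_neg h, if_pos h0, one_mul]

/-- **On the momentum-conservation surface the full phase of a common translation is `1`**:
`k₁ - k₂ - k₃ + k₄ = 0 ⇒ ∏_μ e^{i(-1)^{b_μ}⟨k_μ, t⟩_-} = 1`.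
[cite: FeldmanKnorrerTrubowitz2004Ladders, Definition I.5 (ii) (p.5 L95–108)] -/
theorem prod_legPhase_eq_one_of_surface (k : Fin 4 → SpT) (t : SpT)
    (hk : k 0 - k 1 - k 2 + k 3 = 0) : ∏ μ : Fin 4, legPhase μ (k μ) t = 1 := by
  rw [prod_legPhase_const, sum_neg_one_pow_bExp_smul, hk, mink_zero_left]
  simp

/-- The phase product of the pinned transform (over the position legs other than the pinned one)
equals the product over ALL position legs of the phases at the insertion vector (the pinned leg sits
at the origin and contributes `1`). [cite: FeldmanKnorrerTrubowitz2004Ladders, Definition I.5 (ii) (p.5 L95–108)] -/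
theorem prod_legPhase_legIns {i : LegKind} {π : Fin 4} (hπ : i π = 1) (k k' : Fin 4 → SpT)
    (u : {μ : Fin 4 // i μ = 1 ∧ μ ≠ π} → SpT) :
    (∏ μ : Fin 4, if i μ = 1 then legPhase μ (k μ) (legIns i k' π 0 u μ) else 1) =
      ∏ μ : {μ : Fin 4 // i μ = 1 ∧ μ ≠ π}, legPhase μ.1 (k μ.1) (u μ) := by
  classical
  rw [← Finset.mul_prod_erase Finset.univ _ (Finset.mem_univ π), if_pos hπ, legIns_apply_self,
    legPhase_zero_right, one_mul, ← Finset.prod_filter,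
    Finset.prod_subtype (F := inferInstance) ((Finset.univ.erase π).filter fun μ => i μ = 1)
      (p := fun μ => i μ = 1 ∧ μ ≠ π)
      (fun μ => by simp [Finset.mem_filter, Finset.mem_erase, and_comm])]
  refine Finset.prod_congr rfl fun j _ => ?_
  rw [legIns_apply_of_pos _ _ _ _ _ j.2]

/-- **The translation-invariant integrand.**  For `f` translation invariant (Definition I.4 (ii)) and a
momentum configuration `k` on the conservation surface, the function
`x ↦ (∏_{μ : i_μ = 1} e_μ(k_μ, x_μ)) · f|_i(x)` — on argument vectors `x` whose momentum legs carry
the momenta `k` — is invariant under a common translation of the positions: the phase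
`∏_{μ : i_μ = 0} e_μ(k_μ, t)` produced by `f` cancels against the change of the position phases,
their product being the full phase `∏_μ e_μ(k_μ, t) = 1`.
[cite: FeldmanKnorrerTrubowitz2004Ladders, Definition I.4 (ii) (p.5 L48–64) and Definition I.5 (ii) (p.5 L95–108)] -/
theorem phase_mul_apply_translate {i : LegKind} {f : FourLegFn} (htr : IsTranslationInvariant f)
    (s' : Fin 4 → Arc) (k : Fin 4 → SpT) (hk : k 0 - k 1 - k 2 + k 3 = 0) (X : Fin 4 → SpT)
    (hX : ∀ μ, i μ = 0 → X μ = k μ) (t : SpT) :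
    (∏ μ : Fin 4, if i μ = 1 then legPhase μ (k μ) (translate i t X μ) else 1) *
        f i (translate i t X) s' =
      (∏ μ : Fin 4, if i μ = 1 then legPhase μ (k μ) (X μ) else 1) * f i X s' := by
  have h1 : (∏ μ : Fin 4, if i μ = 1 then legPhase μ (k μ) (translate i t X μ) else 1) =
      (∏ μ : Fin 4, if i μ = 1 then legPhase μ (k μ) (X μ) else 1) *
        ∏ μ : Fin 4, if i μ = 1 then legPhase μ (k μ) t else 1 := by
    rw [← Finset.prod_mul_distrib]
    refine Finset.prod_congr rfl fun μ _ => ?_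
    by_cases h : i μ = 1
    · have h0 : ¬ i μ = 0 := by omega
      rw [if_pos h, if_pos h, if_pos h]
      show legPhase μ (k μ) (if i μ = 0 then X μ else X μ + t) = _
      rw [if_neg h0, legPhase_add_right]
    · rw [if_neg h, if_neg h, if_neg h, mul_one]
  have h2 : f i (translate i t X) s' =
      (∏ μ : Fin 4, if i μ = 0 then legPhase μ (k μ) t else 1) * f i X s' := by
    rw [htr.1 i t X s']
    congr 1
    refine Finset.prod_congr rfl fun μ _ => ?_
    by_cases h0 : i μ = 0
    · rw [if_pos h0, if_pos h0, hX μ h0]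
    · rw [if_neg h0, if_neg h0]
  rw [h1, h2, mul_assoc,
    ← mul_assoc (∏ μ : Fin 4, if i μ = 1 then legPhase μ (k μ) t else 1),
    prod_ite_legPhase_mul_prod_ite, prod_legPhase_eq_one_of_surface k t hk, one_mul]

/-! ### §2 Inserting one coordinate, indexed by an equivalence onto the complement -/

/-- Splitting a finite product at a distinguished index `a`, the other indices being enumerated by an
equivalence `ε : κ' ≃ {m // m ≠ a}`. [cite: FeldmanKnorrerTrubowitz2004Ladders, Definition I.5 (ii) (p.5 L95–108), the pinned position leg] -/
theorem prod_eq_mul_prod_equiv {κ κ' : Type*} [Fintype κ] [Fintype κ'] [DecidableEq κ]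
    {M : Type*} [CommMonoid M] (a : κ) (ε : κ' ≃ {m : κ // m ≠ a}) (h : κ → M) :
    ∏ m, h m = h a * ∏ j, h (ε j).1 := by
  rw [← Finset.mul_prod_erase Finset.univ h (Finset.mem_univ a)]
  congr 1
  rw [Finset.prod_subtype (F := inferInstance) (Finset.univ.erase a) (p := fun m => m ≠ a)
    (fun m => by simp)]
  exact (Fintype.prod_equiv ε (fun j => h (ε j).1) (fun m => h m.1) (fun _ => rfl)).symm

/-- **Inserting one coordinate.**  For a distinguished index `a : κ` and an equivalence
`ε : κ' ≃ {m // m ≠ a}` enumerating the other indices, the map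
`(τ, u) ↦ (m ↦ τ if m = a, u (ε⁻¹ m) otherwise)` is a measurable equivalence
`X × (κ' → X) ≃ᵐ (κ → X)` preserving the product volumes (F7j's `exists_measurableEquiv_insert`,
re-indexed so that an empty complement is allowed). [cite: FeldmanKnorrerTrubowitz2004Ladders, Definition I.5 (ii) (p.5 L95–108) and Definition I.18 (p.8 L55–93)] -/
theorem exists_measurableEquiv_insert' {X : Type*} [MeasureSpace X]
    [SigmaFinite (volume : Measure X)] {κ κ' : Type*} [Fintype κ] [Fintype κ'] [DecidableEq κ]
    (a : κ) (ε : κ' ≃ {m : κ // m ≠ a}) :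
    ∃ Φ : X × (κ' → X) ≃ᵐ (κ → X), MeasurePreserving Φ volume volume ∧
      (∀ (τ : X) (u : κ' → X), (Φ (τ, u) : κ → X) a = τ) ∧
      (∀ (τ : X) (u : κ' → X) (j : κ'), (Φ (τ, u) : κ → X) (ε j).1 = u j) ∧
      ∀ x : κ → X, Φ.symm x = (x a, fun j => x (ε j).1) := by
  let Φ : X × (κ' → X) ≃ᵐ (κ → X) :=
    { toFun := fun z m => if h : m = a then z.1 else z.2 (ε.symm ⟨m, h⟩)
      invFun := fun x => (x a, fun j => x (ε j).1)
      left_inv := by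
        rintro ⟨τ, u⟩
        refine Prod.ext ?_ ?_
        · show (if h : a = a then τ else u (ε.symm ⟨a, h⟩)) = τ
          rw [dif_pos rfl]
        · funext j
          show (if h : (ε j).1 = a then τ else u (ε.symm ⟨(ε j).1, h⟩)) = u j
          rw [dif_neg (ε j).2]
          simp
      right_inv := by
        intro x
        funext m
        show (if h : m = a then x a else x (ε (ε.symm ⟨m, h⟩)).1) = x m
        by_cases hm : m = a
        · subst hm; rw [dif_pos rfl]
        · rw [dif_neg hm]
          simp
      measurable_toFun := by
        show Measurable fun z : X × (κ' → X) => fun m =>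
          if h : m = a then z.1 else z.2 (ε.symm ⟨m, h⟩)
        refine measurable_pi_lambda _ fun m => ?_
        show Measurable fun z : X × (κ' → X) => if h : m = a then z.1 else z.2 (ε.symm ⟨m, h⟩)
        by_cases hm : m = a
        · have h' : (fun z : X × (κ' → X) => if h : m = a then z.1 else z.2 (ε.symm ⟨m, h⟩)) =
              fun z => z.1 := by
            funext z; rw [dif_pos hm]
          rw [h']; exact measurable_fst
        · have h' : (fun z : X × (κ' → X) => if h : m = a then z.1 else z.2 (ε.symm ⟨m, h⟩)) =
              fun z => z.2 (ε.symm ⟨m, hm⟩) := by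
            funext z; rw [dif_neg hm]
          rw [h']; exact (measurable_pi_apply _).comp measurable_snd
      measurable_invFun := by
        show Measurable fun x : κ → X => (x a, fun j => x (ε j).1)
        exact (measurable_pi_apply a).prodMk
          (measurable_pi_lambda _ fun j => measurable_pi_apply (ε j).1) }
  have hΦa : ∀ (τ : X) (u : κ' → X), (Φ (τ, u) : κ → X) a = τ := fun τ u => by
    show (if h : a = a then τ else u (ε.symm ⟨a, h⟩)) = τ
    rw [dif_pos rfl]
  have hΦe : ∀ (τ : X) (u : κ' → X) (j : κ'), (Φ (τ, u) : κ → X) (ε j).1 = u j := fun τ u j => by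
    show (if h : (ε j).1 = a then τ else u (ε.symm ⟨(ε j).1, h⟩)) = u j
    rw [dif_neg (ε j).2]
    simp
  refine ⟨Φ, ⟨Φ.measurable, ?_⟩, hΦa, hΦe, fun _ => rfl⟩
  show Measure.map Φ volume = Measure.pi fun _ => volume
  refine (Measure.pi_eq fun s hs => ?_).symm
  rw [Measure.map_apply Φ.measurable (MeasurableSet.univ_pi hs)]
  have hpre : (Φ : X × (κ' → X) → (κ → X)) ⁻¹' (Set.pi univ s) =
      s a ×ˢ Set.pi univ (fun j => s (ε j).1) := by
    ext ⟨τ, u⟩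
    simp only [Set.mem_preimage, Set.mem_pi, Set.mem_univ, true_implies, Set.mem_prod]
    constructor
    · intro h
      refine ⟨by simpa [hΦa] using h a, fun j => ?_⟩
      have := h (ε j).1
      rwa [hΦe] at this
    · rintro ⟨hτ, hu⟩ m
      by_cases hm : m = a
      · subst hm; rwa [hΦa]
      · obtain ⟨j, hj⟩ : ∃ j, (ε j).1 = m := ⟨ε.symm ⟨m, hm⟩, by simp⟩
        subst hj
        rw [hΦe]
        exact hu j
  rw [hpre, Measure.volume_eq_prod, Measure.prod_prod, volume_pi_pi]
  exact (prod_eq_mul_prod_equiv a ε (fun m => volume (s m))).symm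

/-! ### §2′ Invariance of the volumes on `ℝ × ℝ²` and its powers (as in F7j §2; private) -/

/-- `volume` on `ℝ × ℝ²` is an additive Haar measure. [folklore] -/
private theorem isAddHaarMeasure_volume_SpT : (volume : Measure SpT).IsAddHaarMeasure := by
  rw [Measure.volume_eq_prod]; infer_instance

/-- `volume` on `ℝ × ℝ²` is invariant under `x ↦ -x`. [folklore] -/
private theorem isNegInvariant_volume_SpT : (volume : Measure SpT).IsNegInvariant := by
  haveI := isAddHaarMeasure_volume_SpT; infer_instance

/-- `volume` on a finite power of `ℝ × ℝ²` is translation invariant (right). [folklore] -/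
private theorem isAddRightInvariant_volume_pi_SpT {κ : Type*} [Fintype κ] :
    (volume : Measure (κ → SpT)).IsAddRightInvariant := by
  haveI := isAddHaarMeasure_volume_SpT
  show (Measure.pi fun _ : κ => (volume : Measure SpT)).IsAddRightInvariant
  infer_instance

/-! ### §3 Re-pinning with momentum legs -/

/-- **Re-pinning (general leg kinds).**  For a translation-invariant `f` (Definition I.4 (ii): the
momentum legs produce the phase `∏_{μ : i_μ = 0} e_μ(k_μ, t)`), a momentum configuration `k` on the
conservation surface `k₁ - k₂ - k₃ + k₄ = 0`, and two position legs `π`, `π'` whose pinned slices of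
`f|_i(·, s')` are integrable, the Fourier transform pinned at `π` and the one pinned at `π'` agree
(print: `f̌` "is defined only where `k₁ - k₂ = k₃ - k₄`" — the delta function realised by pinning any
one position leg).  Proof: split off the position of leg `π'` resp. `π` (§2), translate the remaining
positions (Haar invariance; the translation-invariant integrand of §1), reflect the split variable,
Fubini twice. [cite: FeldmanKnorrerTrubowitz2004Ladders, Definition I.5 (ii) (p.5 L95–108)] -/
theorem pinFT_eq_pinFT_of_isTranslationInvariant {i : LegKind} {f : FourLegFn}
    (htr : IsTranslationInvariant f) (s' : Fin 4 → Arc) (k : Fin 4 → SpT)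
    (hk : k 0 - k 1 - k 2 + k 3 = 0) {π π' : Fin 4} (hπ : i π = 1) (hπ' : i π' = 1)
    (hiπ : Integrable fun u : {μ : Fin 4 // i μ = 1 ∧ μ ≠ π} → SpT => f i (legIns i k π 0 u) s')
    (hiπ' : Integrable fun u : {μ : Fin 4 // i μ = 1 ∧ μ ≠ π'} → SpT =>
      f i (legIns i k π' 0 u) s') :
    ∫ u : {μ : Fin 4 // i μ = 1 ∧ μ ≠ π} → SpT,
        (∏ μ : {μ : Fin 4 // i μ = 1 ∧ μ ≠ π}, legPhase μ.1 (k μ.1) (u μ)) *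
          f i (legIns i k π 0 u) s' =
      ∫ u : {μ : Fin 4 // i μ = 1 ∧ μ ≠ π'} → SpT,
        (∏ μ : {μ : Fin 4 // i μ = 1 ∧ μ ≠ π'}, legPhase μ.1 (k μ.1) (u μ)) *
          f i (legIns i k π' 0 u) s' := by
  classical
  rcases eq_or_ne π π' with rfl | hne
  · rfl
  -- the two insertion equivalences over the position legs `∉ {π, π'}`
  let ε : {μ : Fin 4 // i μ = 1 ∧ μ ≠ π ∧ μ ≠ π'} ≃
      {m : {μ : Fin 4 // i μ = 1 ∧ μ ≠ π} // m ≠ ⟨π', hπ', hne.symm⟩} :=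
    { toFun := fun j => ⟨⟨j.1, j.2.1, j.2.2.1⟩, fun h => j.2.2.2 (congrArg Subtype.val h)⟩
      invFun := fun m => ⟨m.1.1, m.1.2.1, m.1.2.2, fun h => m.2 (Subtype.ext h)⟩
      left_inv := fun j => rfl
      right_inv := fun m => rfl }
  let ε' : {μ : Fin 4 // i μ = 1 ∧ μ ≠ π ∧ μ ≠ π'} ≃
      {m : {μ : Fin 4 // i μ = 1 ∧ μ ≠ π'} // m ≠ ⟨π, hπ, hne⟩} :=
    { toFun := fun j => ⟨⟨j.1, j.2.1, j.2.2.2⟩, fun h => j.2.2.1 (congrArg Subtype.val h)⟩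
      invFun := fun m => ⟨m.1.1, m.1.2.1, fun h => m.2 (Subtype.ext h), m.1.2.2⟩
      left_inv := fun j => rfl
      right_inv := fun m => rfl }
  obtain ⟨J, hJmp, hJa, hJe, -⟩ := exists_measurableEquiv_insert' (X := SpT)
    (⟨π', hπ', hne.symm⟩ : {μ : Fin 4 // i μ = 1 ∧ μ ≠ π}) ε
  obtain ⟨J', hJ'mp, hJ'a, hJ'e, -⟩ := exists_measurableEquiv_insert' (X := SpT)
    (⟨π, hπ, hne⟩ : {μ : Fin 4 // i μ = 1 ∧ μ ≠ π'}) ε'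
  -- the two integrands
  set Λ : ({μ : Fin 4 // i μ = 1 ∧ μ ≠ π} → SpT) → ℂ := fun u =>
    (∏ μ : {μ : Fin 4 // i μ = 1 ∧ μ ≠ π}, legPhase μ.1 (k μ.1) (u μ)) *
      f i (legIns i k π 0 u) s' with hΛ
  set Λ' : ({μ : Fin 4 // i μ = 1 ∧ μ ≠ π'} → SpT) → ℂ := fun u =>
    (∏ μ : {μ : Fin 4 // i μ = 1 ∧ μ ≠ π'}, legPhase μ.1 (k μ.1) (u μ)) *
      f i (legIns i k π' 0 u) s' with hΛ'
  -- integrability of the integrands (phases have modulus one)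
  have hΛi : Integrable Λ := by
    refine hiπ.bdd_mul (c := 1) (Continuous.aestronglyMeasurable ?_) (ae_of_all _ fun u => ?_)
    · exact continuous_finsetProd _ fun μ _ => (continuous_legPhase μ.1).comp
        (continuous_const.prodMk (continuous_apply μ))
    · rw [norm_prod]; simp [norm_legPhase]
  have hΛ'i : Integrable Λ' := by
    refine hiπ'.bdd_mul (c := 1) (Continuous.aestronglyMeasurable ?_) (ae_of_all _ fun u => ?_)
    · exact continuous_finsetProd _ fun μ _ => (continuous_legPhase μ.1).comp
        (continuous_const.prodMk (continuous_apply μ))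
    · rw [norm_prod]; simp [norm_legPhase]
  -- the pointwise identity between the two split integrands
  have hkey : ∀ (τ : SpT) (w : {μ : Fin 4 // i μ = 1 ∧ μ ≠ π ∧ μ ≠ π'} → SpT),
      Λ (J (τ, w)) = Λ' (J' (-τ, fun j => w j - τ)) := by
    intro τ w
    -- the two insertion vectors differ by the common translation `-τ` of the positions
    have hXX' : legIns i k π' 0 (J' (-τ, fun j => w j - τ)) =
        translate i (-τ) (legIns i k π 0 (J (τ, w))) := by
      funext μ
      by_cases hμπ : μ = π
      · subst hμπ
        have h0 : ¬ i μ = 0 := by omega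
        rw [legIns_apply_of_pos _ _ _ _ _ ⟨hπ, hne⟩, translate, if_neg h0, legIns_apply_self]
        show (J' (-τ, fun j => w j - τ)) (⟨μ, hπ, hne⟩ : {ν : Fin 4 // i ν = 1 ∧ ν ≠ π'}) = 0 + -τ
        rw [hJ'a, zero_add]
      · by_cases hμπ' : μ = π'
        · subst hμπ'
          have h0 : ¬ i μ = 0 := by omega
          rw [legIns_apply_self, translate, if_neg h0, legIns_apply_of_pos _ _ _ _ _ ⟨hπ', hμπ⟩]
          show (0 : SpT) = (J (τ, w)) (⟨μ, hπ', hμπ⟩ : {ν : Fin 4 // i ν = 1 ∧ ν ≠ π}) + -τ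
          rw [hJa]; abel
        · by_cases h1 : i μ = 1
          · have h0 : ¬ i μ = 0 := by omega
            rw [legIns_apply_of_pos _ _ _ _ _ ⟨h1, hμπ'⟩, translate, if_neg h0,
              legIns_apply_of_pos _ _ _ _ _ ⟨h1, hμπ⟩]
            have e1 : (⟨μ, h1, hμπ'⟩ : {ν : Fin 4 // i ν = 1 ∧ ν ≠ π'}) =
                (ε' ⟨μ, h1, hμπ, hμπ'⟩).1 := rfl
            have e2 : (⟨μ, h1, hμπ⟩ : {ν : Fin 4 // i ν = 1 ∧ ν ≠ π}) =
                (ε ⟨μ, h1, hμπ, hμπ'⟩).1 := rfl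
            rw [e1, hJ'e, e2, hJe]
            simp [sub_eq_add_neg]
          · have h0 : i μ = 0 := by omega
            rw [legIns_apply_of_mom _ _ _ _ _ h1 hμπ', translate, if_pos h0,
              legIns_apply_of_mom _ _ _ _ _ h1 hμπ]
    have hmom : ∀ μ, i μ = 0 → legIns i k π 0 (J (τ, w)) μ = k μ := by
      intro μ h0
      have h1 : ¬ i μ = 1 := by omega
      have hμπ : μ ≠ π := by rintro rfl; omega
      exact legIns_apply_of_mom _ _ _ _ _ h1 hμπ
    calc Λ (J (τ, w))
        = (∏ μ : Fin 4, if i μ = 1 then legPhase μ (k μ) (legIns i k π 0 (J (τ, w)) μ) else 1) *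
            f i (legIns i k π 0 (J (τ, w))) s' := by
          rw [hΛ, prod_legPhase_legIns hπ k k]
      _ = (∏ μ : Fin 4, if i μ = 1 then legPhase μ (k μ)
              (translate i (-τ) (legIns i k π 0 (J (τ, w))) μ) else 1) *
            f i (translate i (-τ) (legIns i k π 0 (J (τ, w)))) s' :=
          (phase_mul_apply_translate htr s' k hk _ hmom (-τ)).symm
      _ = Λ' (J' (-τ, fun j => w j - τ)) := by
          rw [hΛ', ← hXX', prod_legPhase_legIns hπ' k k]
  -- transport both sides to `SpT × (legs ∉ {π, π'} → SpT)` and compare the iterated integrals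
  have hΛJ : Integrable (fun z => Λ (J z)) ((volume : Measure SpT).prod volume) := by
    have := (hJmp.integrable_comp_emb J.measurableEmbedding).2 hΛi
    rwa [Measure.volume_eq_prod] at this
  have hΛ'J' : Integrable (fun z => Λ' (J' z)) ((volume : Measure SpT).prod volume) := by
    have := (hJ'mp.integrable_comp_emb J'.measurableEmbedding).2 hΛ'i
    rwa [Measure.volume_eq_prod] at this
  haveI := isNegInvariant_volume_SpT
  haveI := isAddRightInvariant_volume_pi_SpT (κ := {μ : Fin 4 // i μ = 1 ∧ μ ≠ π ∧ μ ≠ π'})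
  calc ∫ u, Λ u = ∫ z, Λ (J z) := (hJmp.integral_comp' Λ).symm
    _ = ∫ z, Λ (J z) ∂((volume : Measure SpT).prod volume) := rfl
    _ = ∫ τ : SpT, ∫ w : {μ : Fin 4 // i μ = 1 ∧ μ ≠ π ∧ μ ≠ π'} → SpT, Λ (J (τ, w)) :=
        integral_prod _ hΛJ
    _ = ∫ τ : SpT, ∫ w : {μ : Fin 4 // i μ = 1 ∧ μ ≠ π ∧ μ ≠ π'} → SpT, Λ' (J' (-τ, w)) := by
        refine integral_congr_ae (ae_of_all _ fun τ => ?_)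
        show ∫ w, Λ (J (τ, w)) = ∫ w, Λ' (J' (-τ, w))
        simp_rw [hkey τ]
        exact integral_sub_right_eq_self (μ := volume)
          (fun v : {μ : Fin 4 // i μ = 1 ∧ μ ≠ π ∧ μ ≠ π'} → SpT => Λ' (J' (-τ, v))) (fun _ => τ)
    _ = ∫ τ : SpT, ∫ w : {μ : Fin 4 // i μ = 1 ∧ μ ≠ π ∧ μ ≠ π'} → SpT, Λ' (J' (τ, w)) :=
        integral_neg_eq_self (fun τ => ∫ w, Λ' (J' (τ, w))) volume
    _ = ∫ z, Λ' (J' z) ∂((volume : Measure SpT).prod volume) := (integral_prod _ hΛ'J').symm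
    _ = ∫ z, Λ' (J' z) := rfl
    _ = ∫ u, Λ' u := hJ'mp.integral_comp' Λ'

/-- **The pinned transform of a sectorized function vanishes off the old sectors — for ANY pinned
position leg and any leg kinds.**  If `f` is sectorized (Definition I.6, rev. 3) and translation
invariant, the pinned slices of `f|_i(·, s')` at the momenta `k` are integrable, `k` lies on the
surface `k₁ - k₂ - k₃ + k₄ = 0` and `k_ν ∉ s̃'_ν` for some position leg `ν`, then the Fourier
transform pinned at an arbitrary position leg `π` vanishes at `k` (the tree's `totalFT` is the case
`π = Classical.choose _`; the general case follows by re-pinning).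
[cite: FeldmanKnorrerTrubowitz2004Ladders, Definition I.6 (p.5 L110–128) with Definition I.5 (ii) (p.5 L95–108)] -/
theorem pinFT_eq_zero_of_not_mem_extSector' (S : ScaleData) (e : (Fin 2 → ℝ) → ℝ)
    (fr : FermiFrame) {jl jr : ℕ} {i : LegKind} {f : FourLegFn}
    (hsec : IsSectorized S e fr jl jr f) (htr : IsTranslationInvariant f) (s' : Fin 4 → Arc)
    (k : Fin 4 → SpT) (hk : k 0 - k 1 - k 2 + k 3 = 0) {π : Fin 4} (hπ : i π = 1)
    (hint : ∀ π₀ : Fin 4, i π₀ = 1 →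
      Integrable fun u : {μ : Fin 4 // i μ = 1 ∧ μ ≠ π₀} → SpT => f i (legIns i k π₀ 0 u) s')
    {ν : Fin 4} (hν1 : i ν = 1)
    (hν : k ν ∉ extSector S e fr (if ν.val < 2 then jl else jr) (s' ν)) :
    ∫ u : {μ : Fin 4 // i μ = 1 ∧ μ ≠ π} → SpT,
        (∏ μ : {μ : Fin 4 // i μ = 1 ∧ μ ≠ π}, legPhase μ.1 (k μ.1) (u μ)) *
          f i (legIns i k π 0 u) s' = 0 := by
  have h : ∃ μ, i μ = 1 := ⟨π, hπ⟩
  have hc : i h.choose = 1 := h.choose_spec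
  rw [pinFT_eq_pinFT_of_isTranslationInvariant htr s' k hk hπ hc (hint π hπ) (hint _ hc)]
  have := hsec i k s' ν hν1 hk hν
  rw [totalFT_eq_of_exists h (fun y => f i y s') k] at this
  exact this

/-! ### §4 Assembly: the off-diagonal terms vanish for components with at least two position legs -/

/-- The momentum of the pinned leg is determined by conservation: replacing the value at the pinned
leg `π` of an insertion vector by `K := -(-1)^{b_π} Σ_μ (-1)^{b_μ} (legIns … 0 …)_μ` lands on the
surface `k₁ - k₂ - k₃ + k₄ = 0`. [cite: FeldmanKnorrerTrubowitz2004Ladders, Definition I.5 (ii) (p.5 L95–108)] -/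
theorem surface_of_legIns (i : LegKind) (y : Fin 4 → SpT) (π : Fin 4)
    (q : {μ : Fin 4 // i μ = 1 ∧ μ ≠ π} → SpT) :
    let K : SpT := -(((-1 : ℝ) ^ bExp π) •
      ∑ μ : Fin 4, ((-1 : ℝ) ^ bExp μ) • legIns i y π 0 q μ)
    legIns i y π K q 0 - legIns i y π K q 1 - legIns i y π K q 2 + legIns i y π K q 3 = 0 := by
  classical
  intro K
  rw [← sum_neg_one_pow_bExp_smul]
  have hsplit : ∀ g : Fin 4 → SpT, ∑ μ : Fin 4, ((-1 : ℝ) ^ bExp μ) • g μ =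
      ((-1 : ℝ) ^ bExp π) • g π + ∑ μ ∈ Finset.univ.erase π, ((-1 : ℝ) ^ bExp μ) • g μ :=
    fun g => (Finset.add_sum_erase _ _ (Finset.mem_univ π)).symm
  have hagree : ∀ μ ∈ Finset.univ.erase π, ((-1 : ℝ) ^ bExp μ) • legIns i y π K q μ =
      ((-1 : ℝ) ^ bExp μ) • legIns i y π 0 q μ := by
    intro μ hμ
    have hμ' : μ ≠ π := (Finset.mem_erase.1 hμ).1
    congr 1
    by_cases h' : i μ = 1 ∧ μ ≠ π
    · rw [legIns_apply_of_pos _ _ _ _ _ h', legIns_apply_of_pos _ _ _ _ _ h']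
    · have h1 : ¬ i μ = 1 := fun h1 => h' ⟨h1, hμ'⟩
      rw [legIns_apply_of_mom _ _ _ _ _ h1 hμ', legIns_apply_of_mom _ _ _ _ _ h1 hμ']
  rw [hsplit, Finset.sum_congr rfl hagree, legIns_apply_self]
  have h0 : ∑ μ : Fin 4, ((-1 : ℝ) ^ bExp μ) • legIns i y π 0 q μ =
      ∑ μ ∈ Finset.univ.erase π, ((-1 : ℝ) ^ bExp μ) • legIns i y π 0 q μ := by
    rw [hsplit, legIns_apply_self, smul_zero, zero_add]
  rw [← h0]
  show ((-1 : ℝ) ^ bExp π) • -(((-1 : ℝ) ^ bExp π) •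
      ∑ μ : Fin 4, ((-1 : ℝ) ^ bExp μ) • legIns i y π 0 q μ) +
    ∑ μ : Fin 4, ((-1 : ℝ) ^ bExp μ) • legIns i y π 0 q μ = 0
  rw [smul_neg, smul_smul, neg_one_pow_bExp_mul_self, one_smul, neg_add_cancel]

/-- **The off-diagonal terms of a resectorisation vanish (Lemma II.16, support step) — components with
at least two position legs, all changing scale.**  For admissible ladder data, a leg-kind component `i`
with two distinct position legs `ν`, `π`, a function `f` sectorized at the scales `(jl, jr)`
(Definition I.6) and translation invariant (Definition I.4) whose pinned slices `legIns i y π₀ 0 ·` are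
integrable for every position leg `π₀` (momenta read from `y`), a new label `s ν ∈ Σ_{new scale of ν}`
(that scale `≥ 1`), old labels `s'`, and `s̃_ν(new) ∩ s̃'_ν(old) = ∅`: the resectorisation integral
over the position legs (Definition I.18; the product runs over the subtype of any decidable `chg` with
`chg μ ↔ i μ = 1`) vanishes at `y`:
`∫ x', (∏_{μ : i_μ = 1} χ̂_{s_μ}((-1)^{b_μ}(y_μ - x'_μ))) f|_i(x' on the position legs, y on the momentum legs; s') = 0`.
[cite: FeldmanKnorrerTrubowitz2004Ladders, Lemma II.16, proof (p.13 L43–53, "the other cases are similar"), with Definitions I.6 (p.5 L110–128) and I.18 (p.8 L55–93)] -/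
theorem integral_resect_eq_zero_of_extSector_disjoint_gen (D : LadderData) (hD : D.Admissible)
    {jl jr jl' jr' : ℕ} {i : LegKind} {f : FourLegFn}
    (hsec : IsSectorized D.S D.e D.fr jl jr f) (htr : IsTranslationInvariant f)
    (s s' : Fin 4 → Arc) (y : Fin 4 → SpT)
    (hint : ∀ π₀ : Fin 4, i π₀ = 1 →
      Integrable fun u : {μ : Fin 4 // i μ = 1 ∧ μ ≠ π₀} → SpT => f i (legIns i y π₀ 0 u) s')
    {ν π : Fin 4} (hν1 : i ν = 1) (hπ1 : i π = 1) (hνπ : ν ≠ π)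
    (hnew : 1 ≤ (if ν.val < 2 then jl' else jr'))
    (hsν : s ν ∈ (if ν.val < 2 then D.Sig jl' else D.Sig jr'))
    (hν : extSector D.S D.e D.fr (if ν.val < 2 then jl' else jr') (s ν) ∩
        extSector D.S D.e D.fr (if ν.val < 2 then jl else jr) (s' ν) = ∅)
    (chg : Fin 4 → Prop) [DecidablePred chg] (hchg : ∀ μ, chg μ ↔ i μ = 1) :
    ∫ x' : {μ : Fin 4 // chg μ} → SpT,
        (∏ μ : {μ : Fin 4 // chg μ},
            chiHat (D.χ (if μ.1.val < 2 then jl' else jr') (s μ.1))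
              (((-1 : ℝ) ^ bExp μ.1) • (y μ.1 - x' μ))) *
          f i (fun μ => if h : chg μ then x' ⟨μ, h⟩ else y μ) s' = 0 := by
  classical
  -- Step 0: if some cut-off function is not integrable, its `χ̂` is the junk value `0`
  by_cases hχ : ∀ μ : {μ : Fin 4 // chg μ}, Integrable fun p : SpT =>
      ((D.χ (if μ.1.val < 2 then jl' else jr') (s μ.1) p : ℝ) : ℂ)
  swap
  · obtain ⟨μ, hμ⟩ := not_forall.1 hχ
    have h0 : ∀ x, chiHat (D.χ (if μ.1.val < 2 then jl' else jr') (s μ.1)) x = 0 :=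
      chiHat_eq_zero_of_not_integrable _ hμ
    refine integral_eq_zero_of_ae (ae_of_all _ fun x' => ?_)
    show _ = (0 : ℂ)
    beta_reduce
    rw [Finset.prod_eq_zero (Finset.mem_univ μ) (h0 _), zero_mul]
  -- Step 1: the pinned leg `π ≠ ν`, the insertion equivalence at `π`
  have hπc : chg π := (hchg π).mpr hπ1
  set a : {μ : Fin 4 // chg μ} := ⟨π, hπc⟩ with ha
  let ε : {μ : Fin 4 // i μ = 1 ∧ μ ≠ π} ≃ {m : {μ : Fin 4 // chg μ} // m ≠ a} :=
    { toFun := fun j => ⟨⟨j.1, (hchg j.1).mpr j.2.1⟩, fun h => j.2.2 (congrArg Subtype.val h)⟩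
      invFun := fun m => ⟨m.1.1, (hchg m.1.1).mp m.1.2, fun h => m.2 (Subtype.ext h)⟩
      left_inv := fun j => rfl
      right_inv := fun m => rfl }
  obtain ⟨Φ, hΦmp, hΦa, hΦe, -⟩ := exists_measurableEquiv_insert' (X := SpT) a ε
  -- abbreviations
  set χ : Fin 4 → SpT → ℝ := fun μ => D.χ (if μ.val < 2 then jl' else jr') (s μ) with hχdef
  set σ : Fin 4 → ℝ := fun μ => (-1 : ℝ) ^ bExp μ with hσdef
  set F : (Fin 4 → SpT) → ℂ := fun x => f i x s' with hFdef
  set Θ : ({μ : Fin 4 // chg μ} → SpT) → ℂ := fun x' =>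
    (∏ μ : {μ : Fin 4 // chg μ}, chiHat (χ μ.1) ((σ μ.1) • (y μ.1 - x' μ))) *
      F (fun μ => if h : chg μ then x' ⟨μ, h⟩ else y μ) with hΘdef
  -- the pinned slice at `π` (momenta from `y`) and the momentum phase of a translation
  set G : ({μ : Fin 4 // i μ = 1 ∧ μ ≠ π} → SpT) → ℂ := fun v => F (legIns i y π 0 v) with hGdef
  have hG : Integrable G := hint π hπ1
  set ph : SpT → ℂ := fun τ => ∏ μ : Fin 4, if i μ = 0 then legPhase μ (y μ) τ else 1 with hphdef
  -- Step 2: the integrand along the insertion equivalence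
  have hΘΦ : ∀ (τ : SpT) (u : {μ : Fin 4 // i μ = 1 ∧ μ ≠ π} → SpT),
      Θ (Φ (τ, u)) = (chiHat (χ π) (σ π • (y π - τ)) * ph τ) *
        ((fun v : {μ : Fin 4 // i μ = 1 ∧ μ ≠ π} → SpT =>
          (∏ j : {μ : Fin 4 // i μ = 1 ∧ μ ≠ π}, chiHat (χ j.1) (σ j.1 • ((y j.1 - τ) - v j))) * G v)
          (u - fun _ : {μ : Fin 4 // i μ = 1 ∧ μ ≠ π} => τ)) := by
    intro τ u
    -- the argument vector is the translate by `τ` of the slice vector pinned at `π`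
    have hX : (fun μ : Fin 4 => if h : chg μ then (Φ (τ, u)) ⟨μ, h⟩ else y μ) =
        translate i τ (legIns i y π 0 (u - fun _ : {μ : Fin 4 // i μ = 1 ∧ μ ≠ π} => τ)) := by
      funext μ
      by_cases hμ : μ = π
      · subst hμ
        have h0 : ¬ i μ = 0 := by omega
        rw [dif_pos hπc, translate, if_neg h0, legIns_apply_self, zero_add]
        exact hΦa τ u
      · by_cases h1 : i μ = 1
        · have h0 : ¬ i μ = 0 := by omega
          rw [dif_pos ((hchg μ).mpr h1), translate, if_neg h0,
            legIns_apply_of_pos _ _ _ _ _ ⟨h1, hμ⟩]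
          have e1 : (⟨μ, (hchg μ).mpr h1⟩ : {μ : Fin 4 // chg μ}) = (ε ⟨μ, h1, hμ⟩).1 := rfl
          rw [e1, hΦe]
          simp
        · have h0 : i μ = 0 := by omega
          have hc : ¬ chg μ := fun hc => h1 ((hchg μ).mp hc)
          rw [dif_neg hc, translate, if_pos h0, legIns_apply_of_mom _ _ _ _ _ h1 hμ]
    have hmom : ∀ μ, i μ = 0 →
        legIns i y π 0 (u - fun _ : {μ : Fin 4 // i μ = 1 ∧ μ ≠ π} => τ) μ = y μ := by
      intro μ h0
      have h1 : ¬ i μ = 1 := by omega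
      have hμπ : μ ≠ π := by rintro rfl; omega
      exact legIns_apply_of_mom _ _ _ _ _ h1 hμπ
    have hFX : F (fun μ : Fin 4 => if h : chg μ then (Φ (τ, u)) ⟨μ, h⟩ else y μ) =
        ph τ * G (u - fun _ : {μ : Fin 4 // i μ = 1 ∧ μ ≠ π} => τ) := by
      rw [hX, hFdef, hGdef]
      beta_reduce
      rw [htr.1 i τ _ s', hphdef]
      congr 1
      refine Finset.prod_congr rfl fun μ _ => ?_
      by_cases h0 : i μ = 0
      · rw [if_pos h0, if_pos h0, hmom μ h0]
      · rw [if_neg h0, if_neg h0]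
    have hprod : (∏ μ : {μ : Fin 4 // chg μ}, chiHat (χ μ.1) ((σ μ.1) • (y μ.1 - (Φ (τ, u)) μ))) =
        chiHat (χ π) (σ π • (y π - τ)) *
          ∏ j : {μ : Fin 4 // i μ = 1 ∧ μ ≠ π},
            chiHat (χ j.1) (σ j.1 • ((y j.1 - τ) -
              (u - fun _ : {μ : Fin 4 // i μ = 1 ∧ μ ≠ π} => τ) j)) := by
      rw [prod_eq_mul_prod_equiv (M := ℂ) a ε]
      congr 1
      · rw [hΦa]
      · refine Finset.prod_congr rfl fun j _ => ?_
        rw [hΦe]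
        show chiHat (χ j.1) (σ j.1 • (y j.1 - u j)) = _
        congr 2
        simp only [Pi.sub_apply]
        abel
    rw [hΘdef]
    beta_reduce
    rw [hFX, hprod]
    ring
  -- Step 3: the hypothesis of the Fubini lemma — the transform pinned at `π` vanishes where needed
  have HC : ∀ q : {μ : Fin 4 // i μ = 1 ∧ μ ≠ π} → SpT,
      (∏ j : {μ : Fin 4 // i μ = 1 ∧ μ ≠ π}, ((χ j.1) (q j) : ℂ)) *
        ∫ u : {μ : Fin 4 // i μ = 1 ∧ μ ≠ π} → SpT,
          (∏ j : {μ : Fin 4 // i μ = 1 ∧ μ ≠ π},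
            Complex.exp (Complex.I * ((σ j.1 : ℝ) : ℂ) * (mink (q j) (u j) : ℂ))) * G u = 0 := by
    intro q
    by_cases hq : ∃ j : {μ : Fin 4 // i μ = 1 ∧ μ ≠ π}, χ j.1 (q j) = 0
    · obtain ⟨j, hj⟩ := hq
      rw [Finset.prod_eq_zero (Finset.mem_univ j) (by rw [hj]; simp), zero_mul]
    have hq' : ∀ j : {μ : Fin 4 // i μ = 1 ∧ μ ≠ π}, χ j.1 (q j) ≠ 0 := fun j hj => hq ⟨j, hj⟩
    -- the momentum of leg `ν` lies in the NEW extended sector, hence not in the old one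
    have hνnew : q ⟨ν, hν1, hνπ⟩ ∈
        extSector D.S D.e D.fr (if ν.val < 2 then jl' else jr') (s ν) := by
      have hsν' : s ν ∈ D.Sig (if ν.val < 2 then jl' else jr') := by
        have := hsν
        split_ifs at this ⊢ <;> exact this
      exact hD.chi_support _ hnew _ hsν' (hq' ⟨ν, hν1, hνπ⟩)
    have hνold : q ⟨ν, hν1, hνπ⟩ ∉
        extSector D.S D.e D.fr (if ν.val < 2 then jl else jr) (s' ν) := by
      intro hB
      have : q ⟨ν, hν1, hνπ⟩ ∈ extSector D.S D.e D.fr (if ν.val < 2 then jl' else jr') (s ν) ∩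
          extSector D.S D.e D.fr (if ν.val < 2 then jl else jr) (s' ν) := ⟨hνnew, hB⟩
      rw [hν] at this
      exact this
    -- complete `q` (and the momenta of `y`) to a configuration on the conservation surface
    set K : SpT := -(((-1 : ℝ) ^ bExp π) •
      ∑ μ : Fin 4, ((-1 : ℝ) ^ bExp μ) • legIns i y π 0 q μ) with hKdef
    set k : Fin 4 → SpT := legIns i y π K q with hkdef
    have hk : k 0 - k 1 - k 2 + k 3 = 0 := surface_of_legIns i y π q
    have hkj : ∀ j : {μ : Fin 4 // i μ = 1 ∧ μ ≠ π}, k j.1 = q j := fun j =>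
      legIns_apply_of_pos _ _ _ _ _ j.2
    have hky : ∀ μ, ¬ i μ = 1 → k μ = y μ := by
      intro μ h1
      have hμπ : μ ≠ π := by rintro rfl; exact h1 hπ1
      exact legIns_apply_of_mom _ _ _ _ _ h1 hμπ
    have hkν : k ν ∉ extSector D.S D.e D.fr (if ν.val < 2 then jl else jr) (s' ν) := by
      rw [hkj ⟨ν, hν1, hνπ⟩]; exact hνold
    have hint' : ∀ π₀ : Fin 4, i π₀ = 1 →
        Integrable fun u : {μ : Fin 4 // i μ = 1 ∧ μ ≠ π₀} → SpT => f i (legIns i k π₀ 0 u) s' := by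
      intro π₀ hπ₀
      have := hint π₀ hπ₀
      simp_rw [legIns_congr_mom i (fun μ h1 => (hky μ h1).symm) π₀ 0] at this
      exact this
    have hzero := pinFT_eq_zero_of_not_mem_extSector' D.S D.e D.fr hsec htr s' k hk hπ1 hint' hν1 hkν
    have hG' : ∀ u : {μ : Fin 4 // i μ = 1 ∧ μ ≠ π} → SpT,
        (∏ j : {μ : Fin 4 // i μ = 1 ∧ μ ≠ π},
            Complex.exp (Complex.I * ((σ j.1 : ℝ) : ℂ) * (mink (q j) (u j) : ℂ))) * G u =
          (∏ μ : {μ : Fin 4 // i μ = 1 ∧ μ ≠ π}, legPhase μ.1 (k μ.1) (u μ)) *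
            f i (legIns i k π 0 u) s' := by
      intro u
      rw [hGdef, hFdef]
      beta_reduce
      rw [legIns_congr_mom i (fun μ h1 => (hky μ h1).symm) π 0 u]
      congr 1
      refine Finset.prod_congr rfl fun j _ => ?_
      rw [legPhase, hkj j, hσdef]
      push_cast
      ring_nf
    simp_rw [hG']
    rw [hzero, mul_zero]
  -- Step 4: split off the position of leg `π` and conclude
  haveI := isAddRightInvariant_volume_pi_SpT (κ := {μ : Fin 4 // i μ = 1 ∧ μ ≠ π})
  have hinner : ∀ τ : SpT, ∫ u : {μ : Fin 4 // i μ = 1 ∧ μ ≠ π} → SpT, Θ (Φ (τ, u)) = 0 := by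
    intro τ
    set H : ({μ : Fin 4 // i μ = 1 ∧ μ ≠ π} → SpT) → ℂ := fun v =>
      (∏ j : {μ : Fin 4 // i μ = 1 ∧ μ ≠ π}, chiHat (χ j.1) (σ j.1 • ((y j.1 - τ) - v j))) * G v
      with hHdef
    have hfun : (fun u : {μ : Fin 4 // i μ = 1 ∧ μ ≠ π} → SpT => Θ (Φ (τ, u))) =
        fun u => (chiHat (χ π) (σ π • (y π - τ)) * ph τ) *
          H (u - fun _ : {μ : Fin 4 // i μ = 1 ∧ μ ≠ π} => τ) := by
      funext u; rw [hΘΦ τ u]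
    have hH0 : ∫ v, H v = 0 := by
      rw [hHdef]
      exact integral_prod_chiHat_mul_eq_zero (fun j : {μ : Fin 4 // i μ = 1 ∧ μ ≠ π} => χ j.1)
        (fun j => σ j.1) G hG (fun j => hχ ⟨j.1, (hchg j.1).mpr j.2.1⟩) HC (fun j => y j.1 - τ)
    rw [hfun, integral_const_mul,
      integral_sub_right_eq_self H (fun _ : {μ : Fin 4 // i μ = 1 ∧ μ ≠ π} => τ), hH0, mul_zero]
  show ∫ x', Θ x' = 0
  rw [← hΦmp.integral_comp' Θ]
  by_cases hΘi : Integrable (fun z : SpT × ({μ : Fin 4 // i μ = 1 ∧ μ ≠ π} → SpT) => Θ (Φ z))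
      ((volume : Measure SpT).prod volume)
  · calc ∫ z, Θ (Φ z) = ∫ z, Θ (Φ z) ∂((volume : Measure SpT).prod volume) := rfl
      _ = ∫ τ : SpT, ∫ u : {μ : Fin 4 // i μ = 1 ∧ μ ≠ π} → SpT, Θ (Φ (τ, u)) :=
          integral_prod _ hΘi
      _ = 0 := by simp [hinner]
  · calc ∫ z, Θ (Φ z) = ∫ z, Θ (Φ z) ∂((volume : Measure SpT).prod volume) := rfl
      _ = 0 := integral_undef hΘi

/-- **The support input of `resectScaledNormMax_zero_le_of_support` for every component with at least
two position legs, all changing scale.**  In the `hsupp` binder shape of t11's reduction (old scales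
`(jl, jr)` of `f`, new scales `(jl', jr')`, a changing position leg `ν` whose new and old extended
sectors are disjoint), the `s'`-summand `resectTerm` of the resectorisation (Definition I.18) vanishes
identically, for `f` sectorized and translation invariant with integrable pinned slices
(`legIns i y π₀ 0 ·` at every position leg `π₀`; supplied by `integrable_slice_of_scaledNormMax_ne_top`
when the old norm is finite and the component is measurable), provided the component has a second
position leg `π ≠ ν` and ALL its position legs change scale (always the case when `jl' ≠ jl` and
`jr' ≠ jr`). [cite: FeldmanKnorrerTrubowitz2004Ladders, Lemma II.16, proof (p.13 L43–53)] -/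
theorem resectTerm_eq_zero_of_extSector_disjoint_gen (D : LadderData) (hD : D.Admissible)
    {jl jr jl' jr' : ℕ} (h1l : 1 ≤ jl') (h1r : 1 ≤ jr') {i : LegKind}
    (hC : ∀ μ : Fin 4, i μ = 1 → ((μ.val < 2 ∧ jl' ≠ jl) ∨ (2 ≤ μ.val ∧ jr' ≠ jr)))
    {f : FourLegFn} (hsec : IsSectorized D.S D.e D.fr jl jr f) (htr : IsTranslationInvariant f)
    (s s' : Fin 4 → Arc) (y : Fin 4 → SpT)
    (hint : ∀ π₀ : Fin 4, i π₀ = 1 →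
      Integrable fun u : {μ : Fin 4 // i μ = 1 ∧ μ ≠ π₀} → SpT => f i (legIns i y π₀ 0 u) s')
    {ν π : Fin 4} (hν1 : i ν = 1) (hπ1 : i π = 1) (hνπ : ν ≠ π)
    (hsν : s ν ∈ (if ν.val < 2 then D.Sig jl' else D.Sig jr'))
    (hν : extSector D.S D.e D.fr (if ν.val < 2 then jl' else jr') (s ν) ∩
        extSector D.S D.e D.fr (if ν.val < 2 then jl else jr) (s' ν) = ∅) :
    resectTerm D jl jr jl' jr' f i s s' y = 0 := by
  have hnew : 1 ≤ (if ν.val < 2 then jl' else jr') := by split_ifs <;> assumption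
  exact integral_resect_eq_zero_of_extSector_disjoint_gen D hD hsec htr s s' y hint hν1 hπ1 hνπ
    hnew hsν hν (fun μ : Fin 4 => i μ = 1 ∧ ((μ.val < 2 ∧ jl' ≠ jl) ∨ (2 ≤ μ.val ∧ jr' ≠ jr)))
    (fun μ => ⟨fun h => h.1, fun h => ⟨h, hC μ h⟩⟩)

/-- **The printed case `ℓ' < ℓ`, `r' < r` (p.13 L43–44), every component with at least two position
legs**, in the exact binder shape of the `hsupp` premise of t11's
`resectScaledNormMax_zero_le_of_support'` (old scales `(l', r')`, new scales `(l, r)`; the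
integrability of the pinned slices is read from the frozen argument `y`).
[cite: FeldmanKnorrerTrubowitz2004Ladders, Lemma II.16 (p.13 L19–33), proof p.13 L43–53] -/
theorem resectTerm_eq_zero_of_extSector_disjoint_of_two_le (D : LadderData) (hD : D.Admissible)
    {l l' r r' : ℕ} (hl' : 1 ≤ l') (hl : l' < l) (hr' : 1 ≤ r') (hr : r' < r)
    {f : FourLegFn} (hsec : IsSectorized D.S D.e D.fr l' r' f) (htr : IsTranslationInvariant f)
    (i : LegKind) (s s' : Fin 4 → Arc) (μ : Fin 4)
    (hs : AdmissibleLabels (D.Sig l) (D.Sig r) i s) (hμ : i μ = 1)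
    (hπ : ∃ π : Fin 4, i π = 1 ∧ π ≠ μ)
    (hdis : ¬ (extSector D.S D.e D.fr (if μ.val < 2 then l else r) (s μ) ∩
        extSector D.S D.e D.fr (if μ.val < 2 then l' else r') (s' μ)).Nonempty)
    (y : Fin 4 → SpT)
    (hint : ∀ π₀ : Fin 4, i π₀ = 1 →
      Integrable fun u : {ν : Fin 4 // i ν = 1 ∧ ν ≠ π₀} → SpT => f i (legIns i y π₀ 0 u) s') :
    resectTerm D l' r' l r f i s s' y = 0 := by
  obtain ⟨π, hπ1, hπμ⟩ := hπ
  have hC : ∀ ν : Fin 4, i ν = 1 → ((ν.val < 2 ∧ l ≠ l') ∨ (2 ≤ ν.val ∧ r ≠ r')) := by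
    intro ν _
    by_cases hν : ν.val < 2
    · exact Or.inl ⟨hν, by omega⟩
    · exact Or.inr ⟨by omega, by omega⟩
  have hsμ : s μ ∈ (if μ.val < 2 then D.Sig l else D.Sig r) := by
    have h1 := (hs μ).1 hμ
    split_ifs with h
    · exact h1.1 h
    · exact h1.2 (by omega)
  refine resectTerm_eq_zero_of_extSector_disjoint_gen D hD (by omega) (by omega) hC hsec htr s s' y
    hint hμ hπ1 hπμ.symm hsμ ?_
  exact Set.not_nonempty_iff_eq_empty.1 hdis

end FKTLadders

end Literature.MathematicalPhysics.QuantumLattice.FermiRG
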